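import Literature.Barriers.QuantumAdvantage.PPolyOraclesHolds
import Literature.Computability.Cryptography.PseudorandomGeneratorsAnyOWF
import HarnessLib

/-!
# Barrier `PPolyOracles` holds (discharge of the named fact)

Topic `Literature/Barriers/QuantumAdvantage`. PROOF file (theorems only: no definition, no named
fact) discharging the barrier decl
`Literature.Barriers.QuantumAdvantage.PPolyOracles = aaronsonChen2017_thm76 ∧ aaronsonChen2017_thm81`
(`PPolyOracles.lean`; S. Aaronson, L. Chen, *Complexity-theoretic foundations of quantum supremacy
experiments*, CCC 2017, Thms. 7.6 and 8.1) by composing two theorems already in the tree: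

* `PPolyOracles_of_HILL : PRGExist_iff_OWFExist → PPolyOracles` (`PPolyOraclesHolds.lean`: Thm. 7.6
  from pseudorandom generators via Zhandry's PRF/PRP line, Thm. 8.1 the tree theorem
  `aaronsonChen2017_thm81_holds`), and
* `PRGExist_iff_OWFExist_holds : PRGExist_iff_OWFExist`
  (`Literature/Computability/Cryptography/PseudorandomGeneratorsAnyOWF.lean`:
  Håstad–Impagliazzo–Levin–Luby 1999, Thm. 6.2.2, both directions proved).

Also recorded: `aaronsonChen2017_thm76_holds` (Thm. 7.6 as printed, unconditionally in the tree).
Nothing else is introduced.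

## References

* [AaronsonChen2017] S. Aaronson, L. Chen, CCC 2017 = arXiv:1612.05903, Thm. 7.6 (p. 30), Thm. 8.1
  (p. 32), Lemma 7.4 (p. 29).
* [HastadImpagliazzoLevinLuby1999] J. Håstad, R. Impagliazzo, L. A. Levin, M. Luby, *A pseudorandom
  generator from any one-way function*, SIAM J. Comput. 28 (1999), Thm. 1.1 / Thm. 6.2.2.
-/

noncomputable section

namespace Literature.Barriers.QuantumAdvantage

open Literature.Computability.Cryptography

/-- **Aaronson–Chen 2017, Thm. 7.6 holds in the tree**: "Assuming one-way functions exist, there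
exists an oracle `O ∈ P/poly` such that `BPP^O ≠ BQP^O`" — `aaronsonChen2017_thm76_of_HILL` applied
to the discharged HILL theorem `PRGExist_iff_OWFExist_holds`.
[cite: AaronsonChen2017, Thm. 7.6 (p. 30) and Lemma 7.4 (p. 29)]
[cite: HastadImpagliazzoLevinLuby1999, Thm. 1.1] -/
theorem aaronsonChen2017_thm76_holds : aaronsonChen2017_thm76 :=
  aaronsonChen2017_thm76_of_HILL PRGExist_iff_OWFExist_holds

/-- **The barrier `PPolyOracles` (Aaronson–Chen 2017, Thm. 7.6 ∧ Thm. 8.1) holds in the tree**: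
`PPolyOracles_of_HILL` applied to `PRGExist_iff_OWFExist_holds`.
[cite: AaronsonChen2017, Thm. 7.6 (p. 30) and Thm. 8.1 (p. 32)]
[cite: HastadImpagliazzoLevinLuby1999, Thm. 1.1] -/
theorem PPolyOracles_holds : PPolyOracles :=
  PPolyOracles_of_HILL PRGExist_iff_OWFExist_holds

end Literature.Barriers.QuantumAdvantage

end
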